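import Mathlib.NumberTheory.Chebyshev
import Mathlib.Algebra.MvPolynomial.SchwartzZippel
import Literature.Computability.Complexity.PromiseRPAmplification
import Literature.Computability.Complexity.PromiseZPPProofs
import Literature.Computability.Complexity.UniformProbBlocks
import Literature.Computability.Complexity.StackWords
import Literature.Computability.Complexity.BPExpOperator
import HarnessLib

/-!
# The randomised modular zero test: random point, random modulus ⇒ `coRP`
# (Schwartz 1980; Ibarra–Moran 1983; Arora–Barak Lemma 7.5 + §7.2.3)

Class level plus counting (no machine is programmed here). The classical one-sided test for the
vanishing of an integer polynomial given by ANY succinct device (straight-line program, circuit, …):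
evaluate it at a random point of a box `[0, 2^k)^V` MODULO a random `K`-bit number `r`, and declare
"nonzero" iff `r ≥ 2` and the residue is nonzero (Schwartz, J. ACM 27 (1980), §2–3; Ibarra–Moran,
J. ACM 30 (1983), Thm. 4.2: straight-line programs over `ℤ` have a probabilistic polynomial-time
zero test although their values have exponentially many bits; Arora–Barak 2009, Lemma 7.5
(Schwartz–Zippel) with the fingerprinting of §7.2.3). Formalised as a reusable theorem whose only
computational hypothesis is an `FP` evaluator MODULO `r` of the device:

* `ModularZeroTest.mem_coRP_of_modularZeroTest` — given `sem : w ↦ Q_w ∈ ℤ[x_0, …, x_{v(|w|)-1}]`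
  with `deg Q_w ≤ 2^{d(|w|)}` and `Σ|coeff| ≤ 2^{2^{h(|w|)}}` (`v, d, h` polynomials), and a one-bit
  `E ∈ FP` with `E ⟨w, y⟩ = 1 ↔ (r ≤ 1 ∨ r ∣ Q_w(a))` for the modulus `r = modOf K(n) y` and the
  point `a = ptOf k(n) v(n) (pointSeg y)` read off `K(n) + v(n) k(n)` coins (`coinPoly`), the language
  `{w | Q_w = 0}` is in `coRP` (`mem_BPP_of_modularZeroTest`: hence in `BPP`);
* the analysis of one trial, `uniformProb_witness_ge`: for `Q ≠ 0` with values of height `≤ 2^T` on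
  the box, `Pr[r ≥ 2 ∧ r ∤ Q(a)] ≥ (#{primes < 2^K} - T)/2^K - deg Q/2^k` — Schwartz–Zippel on coin
  blocks (`uniformProb_eval_ptOf_eq_zero_le`, transporting Mathlib's
  `MvPolynomial.schwartz_zippel_totalDegree` along the injective reading of blocks) and fingerprinting
  (`uniformProb_badMod_le`: a nonzero `N` has `≤ log₂|N|` prime divisors, `card_badModuli_le`,
  `card_primeFactors_le_of_le_two_pow`), with Chebyshev's bound `#{primes < 2^K} ≥ 2^K/(2K) - 2`
  (`card_primesBelow_two_pow_ge`, from Mathlib's `Chebyshev.psi_ge` / `psi_le_primeCounting_mul_log`);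
* the parameters `kOf`, `KOf`, `coinPoly`, `gapPoly` (block length `h + 3d + 8`, modulus length
  `4h + 8d + 28`, gap `1/(4K)`), with the two numeric facts that make one trial succeed with
  probability `≥ 1/(4K(n))`; the weak one-sided gap is then `coRP` by the tree's
  `mem_PromiseCoRP'_of_weak` (`PromiseRPAmplification.lean`).

Consumer: the randomised identity test for division-free integer circuits (Kabanets–Impagliazzo's
ACIT ∈ coRP on instance codes) behind Bläser–Ikenmeyer–Jindal–Lysikov 2018, Thm. 5
(`Barriers/ValiantsHypothesis/BIJL18Thm5OfRandomizedPIT.lean`): it supplies the modular evaluator `E`.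

## References

* J. T. Schwartz, *Fast probabilistic algorithms for verification of polynomial identities*,
  J. ACM 27 (1980) 701–717, Lemma 1 / Cor. 1 and §3 (modular evaluation) [Schwartz1980].
* O. H. Ibarra, S. Moran, *Probabilistic algorithms for deciding equivalence of straight-line
  programs*, J. ACM 30 (1983) 217–228, §4 [IbarraMoran1983].
* S. Arora, B. Barak, *Computational Complexity: A Modern Approach*, CUP 2009, Lemma 7.5 / A.36
  (Schwartz–Zippel), §7.2.3 (fingerprinting modulo a random prime), §7.4.1 [AroraBarakCC2009].
* G. H. Hardy, E. M. Wright, *An Introduction to the Theory of Numbers*, 6th ed., Thm. 414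
  (Chebyshev's bounds), §22.10 (`ω(n)`) [HardyWright2008].
-/

noncomputable section

namespace Literature.Computability.Complexity

open _root_.Computability Polynomial Finset

namespace ModularZeroTest


/-! ### Primes below a power of two -/

/-- **Chebyshev's lower bound at powers of two**: `π(2^K) ≥ 2^K / K - 2` for `K ≥ 1`
(`ψ(n) ≥ n log 2 - log (n + 1)` and `ψ(n) ≤ π(n) log n`, Mathlib `Chebyshev`).
[cite: HardyWright2008, Thm. 414] -/
theorem primeCounting_two_pow_ge {K : ℕ} (hK : 1 ≤ K) :
    (2 : ℝ) ^ K / K - 2 ≤ (Nat.primeCounting (2 ^ K) : ℝ) := by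
  have hlog2 : 0 < Real.log 2 := Real.log_pos (by norm_num)
  have hK0 : (0 : ℝ) < K := by exact_mod_cast hK
  have h1 := Chebyshev.psi_ge (2 ^ K)
  have h2 := Chebyshev.psi_le_primeCounting_mul_log (2 ^ K)
  have hlogN : Real.log ((2 ^ K : ℕ) : ℝ) = K * Real.log 2 := by
    push_cast
    rw [Real.log_pow]
  rw [hlogN] at h2
  have hN : ((2 ^ K : ℕ) : ℝ) = (2 : ℝ) ^ K := by push_cast; ring
  rw [hN] at h1 h2
  -- `log (2^K + 1) ≤ log (2^(K+1)) = (K+1) log 2 ≤ 2 K log 2`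
  have hlogle : Real.log ((2 : ℝ) ^ K + 1) ≤ 2 * K * Real.log 2 := by
    have hle : (2 : ℝ) ^ K + 1 ≤ 2 ^ (K + 1) := by
      rw [pow_succ]
      have : (1 : ℝ) ≤ 2 ^ K := one_le_pow₀ (by norm_num)
      linarith
    calc Real.log ((2 : ℝ) ^ K + 1) ≤ Real.log (2 ^ (K + 1)) :=
          Real.log_le_log (by positivity) hle
      _ = (K + 1) * Real.log 2 := by rw [Real.log_pow]; push_cast; ring
      _ ≤ 2 * K * Real.log 2 := by
          have : (1 : ℝ) ≤ K := by exact_mod_cast hK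
          nlinarith
  -- combine: `2^K log 2 - 2 K log 2 ≤ π(2^K) · K log 2`
  have h3 : (2 : ℝ) ^ K * Real.log 2 - 2 * K * Real.log 2 ≤ (Nat.primeCounting (2 ^ K) : ℝ) * (K * Real.log 2) := by
    linarith
  have h4 : ((2 : ℝ) ^ K - 2 * K) * Real.log 2 ≤ ((Nat.primeCounting (2 ^ K) : ℝ) * K) * Real.log 2 := by
    nlinarith
  have h5 : (2 : ℝ) ^ K - 2 * K ≤ (Nat.primeCounting (2 ^ K) : ℝ) * K := le_of_mul_le_mul_right h4 hlog2
  rw [div_sub' (ne_of_gt hK0), div_le_iff₀ hK0]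
  linarith

/-- **Primes below `2^K`** (`K ≥ 2`): `#{p < 2^K prime} ≥ 2^K / (2K) - 2`, from the count at
`2^{K-1} ≤ 2^K - 1`. [cite: HardyWright2008, Thm. 414] -/
theorem card_primesBelow_two_pow_ge {K : ℕ} (hK : 2 ≤ K) :
    (2 : ℝ) ^ K / (2 * K) - 2 ≤ ((2 ^ K).primesBelow.card : ℝ) := by
  rw [Nat.primesBelow_card_eq_primeCounting']
  obtain ⟨K', rfl⟩ : ∃ K', K = K' + 1 := ⟨K - 1, by omega⟩
  have hK' : 1 ≤ K' := by omega
  -- `π'(2^(K'+1)) ≥ π'(2^K' + 1) = π(2^K')`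
  have hmono : Nat.primeCounting (2 ^ K') ≤ Nat.primeCounting' (2 ^ (K' + 1)) := by
    rw [Nat.primeCounting_eq_primeCounting'_succ]
    exact Nat.monotone_primeCounting' (by rw [pow_succ]; have := Nat.one_le_two_pow (n := K'); omega)
  have h := primeCounting_two_pow_ge hK'
  have hmono' : (Nat.primeCounting (2 ^ K') : ℝ) ≤ (Nat.primeCounting' (2 ^ (K' + 1)) : ℝ) := by
    exact_mod_cast hmono
  have hK'0 : (0 : ℝ) < K' := by exact_mod_cast hK'
  have hKK : (2 : ℝ) ^ (K' + 1) / (2 * ((K' + 1 : ℕ) : ℝ)) ≤ 2 ^ K' / K' := by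
    rw [pow_succ, div_le_div_iff₀ (by positivity) hK'0]
    push_cast
    nlinarith [pow_pos (show (0:ℝ) < 2 by norm_num) K']
  linarith

/-! ### The number of prime divisors -/

/-- **A nonzero natural number `N ≤ 2^T` has at most `T` prime factors** (`2^{ω(N)} ≤ ∏_{p ∣ N} p ≤ N`;
the first inequality is also `Literature.NumberTheory.Sieve.GPY.two_pow_card_primeFactors_le`, not
imported here to keep the sieve library out of this file's import cone). [cite: HardyWright2008, §22.10] -/
theorem card_primeFactors_le_of_le_two_pow {N T : ℕ} (hN : N ≠ 0) (hT : N ≤ 2 ^ T) :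
    N.primeFactors.card ≤ T := by
  have h2 : 2 ^ N.primeFactors.card ≤ N :=
    calc 2 ^ N.primeFactors.card = ∏ _p ∈ N.primeFactors, 2 := by rw [prod_const]
      _ ≤ ∏ p ∈ N.primeFactors, p := prod_le_prod' fun p hp => (Nat.prime_of_mem_primeFactors hp).two_le
      _ ≤ N := Nat.le_of_dvd (Nat.pos_of_ne_zero hN) (Nat.prod_primeFactors_dvd N)
  exact (Nat.pow_le_pow_iff_right (by norm_num)).1 (h2.trans hT)

/-! ### Good moduli: primes not dividing `N` -/

/-- **Among the numbers `< 2^K`, at least `#{primes < 2^K} - ω(N)` neither are `≤ 1` nor divide the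
nonzero integer `N`**: every prime not dividing `|N|` qualifies.
[cite: AroraBarakCC2009, §7.2.3 (fingerprinting: a random prime misses the few prime divisors)] -/
theorem card_badModuli_le (K : ℕ) {N : ℤ} (hN : N ≠ 0) :
    ((range (2 ^ K)).filter fun r : ℕ => r ≤ 1 ∨ ((r : ℤ) ∣ N)).card + ((2 ^ K).primesBelow.card - N.natAbs.primeFactors.card)
      ≤ 2 ^ K := by
  classical
  set P : Finset ℕ := (2 ^ K).primesBelow.filter fun p => ¬ p ∣ N.natAbs with hP
  -- the good primes are many
  have hPcard : (2 ^ K).primesBelow.card - N.natAbs.primeFactors.card ≤ P.card := by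
    have hsub : (2 ^ K).primesBelow \ N.natAbs.primeFactors ⊆ P := by
      intro p hp
      rw [mem_sdiff] at hp
      rw [hP, mem_filter]
      refine ⟨hp.1, fun hdvd => hp.2 ?_⟩
      exact Nat.mem_primeFactors.2 ⟨(Nat.mem_primesBelow.1 hp.1).2, hdvd, Int.natAbs_ne_zero.2 hN⟩
    exact (le_card_sdiff _ _).trans (card_le_card hsub)
  -- the good primes are disjoint from the bad moduli, inside `range (2^K)`
  have hdisj : Disjoint ((range (2 ^ K)).filter fun r : ℕ => r ≤ 1 ∨ ((r : ℤ) ∣ N)) P := by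
    rw [disjoint_left]
    intro r hr hrP
    rw [mem_filter] at hr
    rw [hP, mem_filter, Nat.mem_primesBelow] at hrP
    rcases hr.2 with h | h
    · exact absurd hrP.1.2.two_le (by omega)
    · exact hrP.2 (Int.natCast_dvd.1 h)
  have hunion : ((range (2 ^ K)).filter fun r : ℕ => r ≤ 1 ∨ ((r : ℤ) ∣ N)) ∪ P ⊆ range (2 ^ K) := by
    intro r hr
    rcases mem_union.1 hr with h | h
    · exact (mem_filter.1 h).1
    · rw [hP, mem_filter, Nat.mem_primesBelow] at h
      exact mem_range.2 h.1.1
  have := card_le_card hunion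
  rw [card_union_of_disjoint hdisj, card_range] at this
  omega


/-! ### Reading a point and a modulus off the coins -/

/-- Block `i` of length `k` of the string `z`: `z[ik, ik + k)`. [folklore] -/
def blockOf (k i : ℕ) (z : List Bool) : List Bool := (z.drop (i * k)).take k

/-- **The point** read off the point segment `z`: coordinate `i < V` is the value of block `i`
(`bitsToNat`, least significant bit first), an integer in `[0, 2^k)`. [cite: AroraBarakCC2009, Lemma 7.5 (random evaluation point)] -/
def ptOf (k V : ℕ) (z : List Bool) : Fin V → ℤ := fun i => (bitsToNat (blockOf k i z) : ℤ)

/-- **The modulus** read off the coins: the value of the first `K` bits. [cite: AroraBarakCC2009, §7.2.3 (fingerprinting modulo a random number)] -/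
def modOf (K : ℕ) (y : List Bool) : ℕ := bitsToNat (y.take K)

/-- Block `0` is the prefix. [folklore] -/
private theorem blockOf_zero (k : ℕ) (z : List Bool) : blockOf k 0 z = z.take k := by simp [blockOf]

/-- Block `i + 1` of `z` is block `i` of `z.drop k`. [folklore] -/
private theorem blockOf_succ (k i : ℕ) (z : List Bool) : blockOf k (i + 1) z = blockOf k i (z.drop k) := by
  simp only [blockOf, List.drop_drop]
  congr 2
  ring

/-- A block has length at most `k`. [folklore] -/
private theorem length_blockOf_le (k i : ℕ) (z : List Bool) : (blockOf k i z).length ≤ k := by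
  simp [blockOf, List.length_take]

/-- Inside a string of `V` blocks every block has length exactly `k`. [folklore] -/
private theorem length_blockOf {k V i : ℕ} {z : List Bool} (hz : z.length = V * k) (hi : i < V) :
    (blockOf k i z).length = k := by
  simp only [blockOf, List.length_take, List.length_drop, hz]
  have : (i + 1) * k ≤ V * k := Nat.mul_le_mul_right k hi
  rw [Nat.succ_mul] at this
  omega

/-- The coordinates of the point are in `[0, 2^k)` (the sample box of the random evaluation). [cite: AroraBarakCC2009, Lemma 7.5] -/
theorem ptOf_lt (k V : ℕ) (z : List Bool) (i : Fin V) : ptOf k V z i < 2 ^ k := by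
  have h := bitsToNat_lt (blockOf k i z)
  have h' : 2 ^ (blockOf k i z).length ≤ 2 ^ k := Nat.pow_le_pow_right (by norm_num) (length_blockOf_le k i z)
  simp only [ptOf]
  exact_mod_cast h.trans_le h'

/-- The coordinates of the point are nonnegative. [cite: AroraBarakCC2009, Lemma 7.5] -/
theorem ptOf_nonneg (k V : ℕ) (z : List Bool) (i : Fin V) : 0 ≤ ptOf k V z i := by
  simp [ptOf]

/-- **A string of `V` blocks is determined by its blocks.** [folklore] -/
private theorem eq_of_blockOf_eq {k : ℕ} : ∀ {V : ℕ} {z z' : List Bool}, z.length = V * k → z'.length = V * k →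
    (∀ i < V, blockOf k i z = blockOf k i z') → z = z'
  | 0, z, z', hz, hz', _ => by
    rw [Nat.zero_mul, List.length_eq_zero_iff] at hz hz'
    rw [hz, hz']
  | V + 1, z, z', hz, hz', h => by
    have h0 := h 0 (Nat.succ_pos V)
    rw [blockOf_zero, blockOf_zero] at h0
    have hrest : z.drop k = z'.drop k :=
      eq_of_blockOf_eq (k := k) (V := V) (by rw [List.length_drop, hz, Nat.succ_mul]; omega)
        (by rw [List.length_drop, hz', Nat.succ_mul]; omega)
        fun i hi => by rw [← blockOf_succ, ← blockOf_succ]; exact h (i + 1) (by omega)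
    rw [← List.take_append_drop k z, ← List.take_append_drop k z', h0, hrest]

/-! ### Schwartz–Zippel on coin blocks -/

/-- The sample set `[0, 2^k) ⊆ ℤ`. [folklore] -/
def sampleSet (k : ℕ) : Finset ℤ := (range (2 ^ k)).image (Nat.cast : ℕ → ℤ)

/-- `#[0, 2^k) = 2^k`. [folklore] -/
private theorem card_sampleSet (k : ℕ) : (sampleSet k).card = 2 ^ k := by
  rw [sampleSet, card_image_of_injective _ Nat.cast_injective, card_range]

/-- **The strings with a given property of their point are at most as many as the points in
`[0, 2^k)^V` with that property** (the blocks determine the string). [folklore] -/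
private theorem cnt_ptOf_le (k V : ℕ) (P : (Fin V → ℤ) → Prop) [DecidablePred P] :
    cnt (V * k) {z | P (ptOf k V z)} ≤
      ((Fintype.piFinset fun _ : Fin V => sampleSet k).filter P).card := by
  classical
  unfold cnt
  refine card_le_card_of_injOn (fun r : List.Vector Bool (V * k) => ptOf k V r.toList)
    (fun r hr => ?_) (fun r hr r' hr' h => ?_)
  · simp only [coe_filter, mem_univ, true_and, Set.mem_setOf_eq] at hr
    simp only [coe_filter, Fintype.mem_piFinset, Set.mem_setOf_eq]
    refine ⟨fun i => ?_, hr⟩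
    rw [sampleSet, mem_image]
    refine ⟨bitsToNat (blockOf k i r.toList), mem_range.2 ?_, rfl⟩
    exact (bitsToNat_lt _).trans_le (Nat.pow_le_pow_right (by norm_num) (length_blockOf_le k i _))
  · apply List.Vector.toList_injective
    refine eq_of_blockOf_eq (V := V) (k := k) (by simp) (by simp) fun i hi => ?_
    have hi' := congrFun h ⟨i, hi⟩
    simp only [ptOf, Nat.cast_inj] at hi'
    exact bitsToNat_injOn_length k (length_blockOf (by simp) hi) (length_blockOf (by simp) hi) hi'

/-- **Schwartz–Zippel on the coins**: for a nonzero `Q ∈ ℤ[x_0, …, x_{V-1}]` the point read off a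
uniform string of `V` blocks of `k` bits is a zero of `Q` with probability `≤ deg Q / 2^k`.
[cite: AroraBarakCC2009, Lemma 7.5 (Schwartz–Zippel)] -/
theorem uniformProb_eval_ptOf_eq_zero_le {V k : ℕ} {Q : MvPolynomial (Fin V) ℤ} (hQ : Q ≠ 0) :
    uniformProb (V * k) {z | MvPolynomial.eval (ptOf k V z) Q = 0} ≤ (Q.totalDegree : ℝ) / 2 ^ k := by
  classical
  have hSZ := MvPolynomial.schwartz_zippel_totalDegree hQ (sampleSet k)
  rw [card_sampleSet] at hSZ
  have hS : (0 : ℚ≥0) < (2 ^ k : ℕ) := by exact_mod_cast Nat.two_pow_pos k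
  have hSV : (0 : ℚ≥0) < ((2 ^ k : ℕ) : ℚ≥0) ^ V := pow_pos hS V
  rw [div_le_div_iff₀ hSV hS] at hSZ
  have hnat : ((Fintype.piFinset fun _ : Fin V => sampleSet k).filter
      fun f => MvPolynomial.eval f Q = 0).card * 2 ^ k ≤ Q.totalDegree * (2 ^ k) ^ V := by
    exact_mod_cast hSZ
  have hcnt := cnt_ptOf_le k V (fun f => MvPolynomial.eval f Q = 0)
  rw [uniformProb_eq_cnt_div, div_le_div_iff₀ (by positivity) (by positivity)]
  have h1 : (cnt (V * k) {z | MvPolynomial.eval (ptOf k V z) Q = 0} : ℝ) * 2 ^ k ≤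
      (Q.totalDegree : ℝ) * (2 ^ k) ^ V := by
    have := hcnt.trans' le_rfl
    exact_mod_cast (Nat.mul_le_mul_right (2 ^ k) hcnt).trans hnat
  calc (cnt (V * k) {z | MvPolynomial.eval (ptOf k V z) Q = 0} : ℝ) * 2 ^ k
      ≤ (Q.totalDegree : ℝ) * (2 ^ k) ^ V := h1
    _ = (Q.totalDegree : ℝ) * 2 ^ (V * k) := by rw [← pow_mul, mul_comm k V]

/-! ### The height of a value -/

/-- **Height bound**: at a point with coordinates of absolute value `≤ B` (`B ≥ 1`) an integer
polynomial takes a value of absolute value at most `(Σ |coefficients|) · B ^ {total degree}`.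
[cite: BlaserIkenmeyerJindalLysikov2018, Lemma 25 (coefficient and value bounds)] -/
private theorem abs_eval_le {V : ℕ} (Q : MvPolynomial (Fin V) ℤ) {a : Fin V → ℤ} {B : ℕ} (hB : 1 ≤ B)
    (ha : ∀ i, |a i| ≤ B) :
    |MvPolynomial.eval a Q| ≤ (∑ m ∈ Q.support, |Q.coeff m|) * (B : ℤ) ^ Q.totalDegree := by
  rw [MvPolynomial.eval_eq', sum_mul]
  refine (abs_sum_le_sum_abs _ _).trans (sum_le_sum fun m hm => ?_)
  rw [abs_mul, Finset.abs_prod]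
  refine mul_le_mul_of_nonneg_left ?_ (abs_nonneg _)
  calc ∏ i, |a i ^ m i| = ∏ i, |a i| ^ m i := prod_congr rfl fun i _ => abs_pow _ _
    _ ≤ ∏ i, (B : ℤ) ^ m i := prod_le_prod (fun i _ => by positivity)
        fun i _ => pow_le_pow_left₀ (abs_nonneg _) (ha i) _
    _ = (B : ℤ) ^ ∑ i, m i := (prod_pow_eq_pow_sum _ _ _)
    _ ≤ (B : ℤ) ^ Q.totalDegree := by
        refine pow_le_pow_right₀ (by exact_mod_cast hB) ?_
        have h := MvPolynomial.le_totalDegree hm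
        rwa [Finsupp.sum_fintype _ _ (fun _ => rfl)] at h

/-! ### One random modulus -/

/-- **Bad moduli are few**: if `N ≠ 0`, the `K`-bit strings whose value is `≤ 1` or divides `N`
have probability at most `1 - (#{primes < 2^K} - ω(N)) / 2^K`.
[cite: AroraBarakCC2009, §7.2.3 (fingerprinting modulo a random prime)] -/
theorem uniformProb_badMod_le (K : ℕ) {N : ℤ} (hN : N ≠ 0) :
    uniformProb K {u | bitsToNat u ≤ 1 ∨ (bitsToNat u : ℤ) ∣ N} ≤
      1 - (((2 ^ K).primesBelow.card : ℝ) - N.natAbs.primeFactors.card) / 2 ^ K := by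
  classical
  -- count through the injection `bitsToNat` on `{0,1}^K`
  have hcnt : cnt K {u | bitsToNat u ≤ 1 ∨ (bitsToNat u : ℤ) ∣ N} ≤
      ((range (2 ^ K)).filter fun r : ℕ => r ≤ 1 ∨ ((r : ℤ) ∣ N)).card := by
    unfold cnt
    refine card_le_card_of_injOn (fun r : List.Vector Bool K => bitsToNat r.toList) (fun r hr => ?_)
      (fun r _ r' _ h => ?_)
    · simp only [coe_filter, mem_univ, true_and, Set.mem_setOf_eq] at hr
      simp only [coe_filter, mem_range, Set.mem_setOf_eq]
      exact ⟨by simpa using bitsToNat_lt r.toList, hr⟩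
    · exact List.Vector.toList_injective (bitsToNat_injOn_length K (by simp) (by simp) h)
  have hbad := card_badModuli_le K hN
  have h2 : (0 : ℝ) < 2 ^ K := by positivity
  rw [uniformProb_eq_cnt_div, div_le_iff₀ h2, sub_mul, div_mul_cancel₀ _ (ne_of_gt h2), one_mul]
  have h3 : (cnt K {u | bitsToNat u ≤ 1 ∨ (bitsToNat u : ℤ) ∣ N} : ℝ) +
      (((2 ^ K).primesBelow.card - N.natAbs.primeFactors.card : ℕ) : ℝ) ≤ (2 ^ K : ℕ) := by
    exact_mod_cast (Nat.add_le_add_right hcnt _).trans hbad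
  have h4 : ((2 ^ K).primesBelow.card : ℝ) - N.natAbs.primeFactors.card ≤
      (((2 ^ K).primesBelow.card - N.natAbs.primeFactors.card : ℕ) : ℝ) := by
    rw [sub_le_iff_le_add]
    exact_mod_cast le_tsub_add
  push_cast at h3
  linarith

/-! ### The parameters of the test -/

section Params

variable (v d h : Polynomial ℕ)

/-- **Block length of a point coordinate**: `k(n) = h(n) + 3 d(n) + 8`. [folklore] -/
def kOf (n : ℕ) : ℕ := h.eval n + 3 * d.eval n + 8

/-- **Exponent of the height bound**: `t(n) = 2 h(n) + 4 d(n) + 9` (`|Q(a)| ≤ 2^(2^t)`). [folklore] -/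
def tOf (n : ℕ) : ℕ := 2 * h.eval n + 4 * d.eval n + 9

/-- **Bit length of the modulus**: `K(n) = 4 h(n) + 8 d(n) + 28 = 2 t(n) + 10`. [folklore] -/
def KOf (n : ℕ) : ℕ := 4 * h.eval n + 8 * d.eval n + 28

/-- **The coin polynomial**: `K(n) + v(n) · k(n)` coins (modulus first, then `v(n)` point blocks).
[cite: AroraBarakCC2009, Lemma 7.5 and §7.2.3] -/
def coinPoly : Polynomial ℕ :=
  (Polynomial.C 4 * h + Polynomial.C 8 * d + Polynomial.C 28) + v * (h + Polynomial.C 3 * d + Polynomial.C 8)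

/-- **The gap polynomial**: one trial witnesses nonvanishing with probability `≥ 1/(4 K(n))`,
`4 K(n) = gapPoly(n) + 1`. [folklore] -/
def gapPoly : Polynomial ℕ := Polynomial.C 16 * h + Polynomial.C 32 * d + Polynomial.C 111

variable {v d h}

/-- Value of the coin polynomial: `K(n)` modulus bits and `v(n)` blocks of `k(n)` point bits. [cite: AroraBarakCC2009, Lemma 7.5 and §7.2.3] -/
theorem eval_coinPoly (n : ℕ) : (coinPoly v d h).eval n = KOf d h n + v.eval n * kOf d h n := by
  simp [coinPoly, KOf, kOf]

/-- Value of the gap polynomial: `gapPoly(n) + 1 = 4K(n)`, the reciprocal of the one-trial gap. [cite: AroraBarakCC2009, §7.4.1 (the success constant of RP is immaterial)] -/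
theorem eval_gapPoly_add_one (n : ℕ) : (gapPoly d h).eval n + 1 = 4 * KOf d h n := by
  simp [gapPoly, KOf]; ring

/-- `K(n) = 2 t(n) + 10`. [folklore] -/
private theorem KOf_eq (n : ℕ) : KOf d h n = 2 * tOf d h n + 10 := by
  simp [KOf, tOf]; ring

/-- `K(n) ≥ 2`. [folklore] -/
private theorem two_le_KOf (n : ℕ) : 2 ≤ KOf d h n := by simp [KOf]

/-- `32 x + 224 ≤ 2^(x+8)`. [folklore] -/
private theorem lin_le_two_pow_add_eight (x : ℕ) : 32 * x + 224 ≤ 2 ^ (x + 8) := by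
  induction x with
  | zero => norm_num
  | succ x ih => rw [show x + 1 + 8 = (x + 8) + 1 by ring, pow_succ]; omega

/-- `2 t + 10 ≤ 2^(t+4)`. [folklore] -/
private theorem lin_le_two_pow_add_four (t : ℕ) : 2 * t + 10 ≤ 2 ^ (t + 4) := by
  induction t with
  | zero => norm_num
  | succ t ih => rw [show t + 1 + 4 = (t + 4) + 1 by ring, pow_succ]; omega

/-- **First numeric fact**: `8 K · 2^d ≤ 2^k` (the point is a zero with probability `≤ 1/(8K)`). [folklore] -/
private theorem eight_K_two_pow_d_le (n : ℕ) : 8 * KOf d h n * 2 ^ d.eval n ≤ 2 ^ kOf d h n := by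
  have h1 := lin_le_two_pow_add_eight (h.eval n + 2 * d.eval n)
  have h2 : 8 * KOf d h n ≤ 2 ^ (h.eval n + 2 * d.eval n + 8) := by
    refine le_trans ?_ h1
    simp [KOf]; omega
  calc 8 * KOf d h n * 2 ^ d.eval n ≤ 2 ^ (h.eval n + 2 * d.eval n + 8) * 2 ^ d.eval n :=
        Nat.mul_le_mul_right _ h2
    _ = 2 ^ kOf d h n := by rw [← pow_add, kOf]; congr 1; ring

/-- **Second numeric fact**: `8 K (2^t + 2) ≤ 2^K` (a random modulus is a good prime with
probability `≥ 1/(2K) - 1/(8K)`). [folklore] -/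
private theorem eight_K_height_le (n : ℕ) : 8 * KOf d h n * (2 ^ tOf d h n + 2) ≤ 2 ^ KOf d h n := by
  set t := tOf d h n with ht
  have h1 : KOf d h n ≤ 2 ^ (t + 4) := by rw [KOf_eq]; exact lin_le_two_pow_add_four t
  have h2 : 2 ^ t + 2 ≤ 2 ^ (t + 2) := by
    rw [pow_add]; have := Nat.one_le_two_pow (n := t); omega
  calc 8 * KOf d h n * (2 ^ t + 2) ≤ 8 * 2 ^ (t + 4) * 2 ^ (t + 2) :=
        Nat.mul_le_mul (Nat.mul_le_mul_left 8 h1) h2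
    _ = 2 ^ (2 * t + 9) := by
        rw [show (8 : ℕ) = 2 ^ 3 by norm_num, ← pow_add, ← pow_add]; congr 1; ring
    _ ≤ 2 ^ KOf d h n := Nat.pow_le_pow_right (by norm_num) (by rw [KOf_eq]; omega)

/-- **The height exponent**: `2^h + k · 2^d ≤ 2^t`. [folklore] -/
private theorem height_exponent_le (n : ℕ) : 2 ^ h.eval n + kOf d h n * 2 ^ d.eval n ≤ 2 ^ tOf d h n := by
  have hk : kOf d h n ≤ 2 ^ kOf d h n := (Nat.lt_two_pow_self).le
  have h1 : kOf d h n * 2 ^ d.eval n ≤ 2 ^ (kOf d h n + d.eval n) := by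
    rw [pow_add]; exact Nat.mul_le_mul_right _ hk
  have h2 : 2 ^ h.eval n ≤ 2 ^ (h.eval n + d.eval n + kOf d h n) := Nat.pow_le_pow_right (by norm_num) (by omega)
  have h3 : 2 ^ (kOf d h n + d.eval n) ≤ 2 ^ (h.eval n + d.eval n + kOf d h n) :=
    Nat.pow_le_pow_right (by norm_num) (by omega)
  have h4 : tOf d h n = (h.eval n + d.eval n + kOf d h n) + 1 := by simp [tOf, kOf]; ring
  rw [h4, pow_succ]
  omega

end Params

/-! ### One trial: the witness probability -/

/-- **The witness probability of one trial.** For a nonzero `Q ∈ ℤ[x_0, …, x_{V-1}]` whose values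
at points of `[0, 2^k)^V` have absolute value `≤ 2^T`: a uniform string `y` of `K + V k` coins, read
as a modulus `r` (first `K` bits) and a point `a` (`V` blocks of `k` bits), satisfies
`r ≥ 2 ∧ r ∤ Q(a)` with probability at least `(#{primes < 2^K} - T)/2^K - deg Q / 2^k`
(Schwartz–Zippel for the point, then fingerprinting: a uniform prime `< 2^K` misses the `≤ T` prime
divisors of `Q(a) ≠ 0`). [cite: AroraBarakCC2009, Lemma 7.5 and §7.2.3] -/
theorem uniformProb_witness_ge {V k K T : ℕ} {Q : MvPolynomial (Fin V) ℤ} (hQ : Q ≠ 0)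
    (hheight : ∀ z : List Bool, (MvPolynomial.eval (ptOf k V z) Q).natAbs ≤ 2 ^ T) :
    (((2 ^ K).primesBelow.card : ℝ) - T) / 2 ^ K - (Q.totalDegree : ℝ) / 2 ^ k ≤
      uniformProb (K + V * k)
        {y | ¬ (modOf K y ≤ 1 ∨ ((modOf K y : ℤ) ∣ MvPolynomial.eval (ptOf k V (y.drop K)) Q))} := by
  classical
  set N : List Bool → ℤ := fun z => MvPolynomial.eval (ptOf k V z) Q with hN
  set Bad : Set (List Bool) := {y | modOf K y ≤ 1 ∨ ((modOf K y : ℤ) ∣ N (y.drop K))} with hBad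
  set E1 : Set (List Bool) := {y | N (y.drop K) = 0} with hE1
  set Bset : List Bool → List Bool → Set (List Bool) := fun _ z =>
    if N z ≠ 0 then {u | bitsToNat u ≤ 1 ∨ (bitsToNat u : ℤ) ∣ N z} else ∅ with hBset
  set E2 : Set (List Bool) := {y | (y.drop 0).take K ∈ Bset (y.take 0) (y.drop (0 + K))} with hE2
  set δ : ℝ := 1 - (((2 ^ K).primesBelow.card : ℝ) - T) / 2 ^ K with hδ
  -- the good event is the complement of the bad one
  have hgood : {y : List Bool | ¬ (modOf K y ≤ 1 ∨ ((modOf K y : ℤ) ∣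
      MvPolynomial.eval (ptOf k V (y.drop K)) Q))} = Badᶜ := by
    ext y; simp [hBad, hN]
  rw [hgood, uniformProb_compl]
  -- `Bad ⊆ E1 ∪ E2`
  have hsub : Bad ⊆ E1 ∪ E2 := by
    intro y hy
    by_cases h0 : N (y.drop K) = 0
    · exact Or.inl h0
    · refine Or.inr ?_
      simp only [hE2, Set.mem_setOf_eq, List.drop_zero, zero_add, hBset, if_pos h0, List.take_zero]
      simpa [hBad, modOf] using hy
  -- the point is a zero with small probability
  have h1 : uniformProb (K + V * k) E1 ≤ (Q.totalDegree : ℝ) / 2 ^ k := by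
    have hset : E1 = {y | y.take K ∈ (Set.univ : Set (List Bool)) ∧ y.drop K ∈ {z | N z = 0}} := by
      ext y; simp [hE1]
    have hcnt : cnt (K + V * k) E1 = 2 ^ K * cnt (V * k) {z | N z = 0} := by
      rw [hset, cnt_take_drop, cnt_univ]
    have h2K : (0 : ℝ) < 2 ^ K := by positivity
    calc uniformProb (K + V * k) E1 = uniformProb (V * k) {z | N z = 0} := by
          rw [uniformProb_eq_cnt_div, uniformProb_eq_cnt_div, hcnt, pow_add, Nat.cast_mul]
          push_cast
          rw [mul_div_mul_left _ _ (ne_of_gt h2K)]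
      _ ≤ (Q.totalDegree : ℝ) / 2 ^ k := uniformProb_eval_ptOf_eq_zero_le hQ
  -- the modulus is bad with probability `≤ δ`, whatever the point
  have hδ0 : 0 ≤ δ := by
    rw [hδ, sub_nonneg, div_le_one (by positivity)]
    have hπ : ((2 ^ K).primesBelow.card : ℝ) ≤ 2 ^ K := by
      have : (2 ^ K).primesBelow.card ≤ 2 ^ K := by
        have h := card_le_card (show (2 ^ K).primesBelow ⊆ range (2 ^ K) from
          fun p hp => mem_range.2 (Nat.mem_primesBelow.1 hp).1)
        rwa [card_range] at h
      exact_mod_cast this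
    linarith [(Nat.cast_nonneg T : (0 : ℝ) ≤ T)]
  have h2 : uniformProb (0 + K + V * k) E2 ≤ δ := by
    refine uniformProb_block_le' Bset fun w z _ _ => ?_
    by_cases hz : N z = 0
    · simp only [hBset, hz, ne_eq, not_true_eq_false, if_false, uniformProb_empty]
      exact hδ0
    · simp only [hBset, hz, ne_eq, not_false_eq_true, if_true]
      refine (uniformProb_badMod_le K hz).trans ?_
      have hω : (N z).natAbs.primeFactors.card ≤ T :=
        card_primeFactors_le_of_le_two_pow (Int.natAbs_ne_zero.2 hz) (hheight z)
      have hω' : ((N z).natAbs.primeFactors.card : ℝ) ≤ T := by exact_mod_cast hω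
      rw [hδ]
      gcongr
  rw [zero_add] at h2
  have hle : uniformProb (K + V * k) Bad ≤ (Q.totalDegree : ℝ) / 2 ^ k + δ :=
    calc uniformProb (K + V * k) Bad ≤ uniformProb (K + V * k) (E1 ∪ E2) :=
          BPExp.uniformProb_mono_len fun y hy _ => hsub hy
      _ ≤ uniformProb (K + V * k) E1 + uniformProb (K + V * k) E2 := uniformProb_union_le _ _ _
      _ ≤ (Q.totalDegree : ℝ) / 2 ^ k + δ := add_le_add h1 h2
  rw [hδ] at hle
  linarith

/-! ### The randomised modular zero test -/

section Main

variable {v d h : Polynomial ℕ}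

/-- The point segment of the coins of input length `n`: drop the `K(n)` modulus bits. [folklore] -/
def pointSeg (d h : Polynomial ℕ) (n : ℕ) (y : List Bool) : List Bool := y.drop (KOf d h n)

/-- **The randomised modular zero test puts `{w | sem w = 0}` in `coRP`** (Schwartz 1980, Cor. 1 and §3;
Ibarra–Moran 1983, §4; Arora–Barak 2009, Lemma 7.5 with the fingerprinting of §7.2.3). Data: to every string `w`
(length `n`) an integer polynomial `sem w` in `v(n)` variables of total degree `≤ 2^{d(n)}` and with
`Σ |coefficients| ≤ 2^{2^{h(n)}}`; a polynomial-time ONE-BIT function `E` which, on `⟨w, y⟩` with `y`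
of length `K(n) + v(n) k(n)`, answers `1` iff the modulus `r = modOf K(n) y` is `≤ 1` or divides the
value of `sem w` at the point `ptOf k(n) v(n)` of the point segment (i.e. the value VANISHES modulo
`r`; this is what an evaluator working modulo `r` computes). Then `{w | sem w = 0} ∈ coRP`: on a zero
polynomial every coin string is accepted; on a nonzero one a single trial rejects with probability
`≥ 1/(4K(n))` (`uniformProb_witness_ge` with the numeric facts above), and `1/poly` one-sided gaps
are `coRP` (`mem_PromiseCoRP'_of_weak`).
[cite: AroraBarakCC2009, Lemma 7.5 and §7.2.3] [cite: Schwartz1980, Cor. 1] -/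
theorem mem_coRP_of_modularZeroTest
    (sem : (w : List Bool) → MvPolynomial (Fin (v.eval w.length)) ℤ)
    (hdeg : ∀ w, (sem w).totalDegree ≤ 2 ^ d.eval w.length)
    (hL1 : ∀ w, ∑ m ∈ (sem w).support, |(sem w).coeff m| ≤ 2 ^ (2 ^ h.eval w.length))
    {E : List Bool → List Bool} (hE : E ∈ FP) (hbit : ∀ z, E z = [true] ∨ E z = [false])
    (hspec : ∀ w y, y.length = (coinPoly v d h).eval w.length →
      (E (boolPair w y) = [true] ↔
        (modOf (KOf d h w.length) y ≤ 1 ∨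
          ((modOf (KOf d h w.length) y : ℤ) ∣
            MvPolynomial.eval (ptOf (kOf d h w.length) (v.eval w.length) (pointSeg d h w.length y)) (sem w))))) :
    ({w | sem w = 0} : Language Bool) ∈ coRP := by
  classical
  set L'' : Language Bool := {z | E z = [true]} with hL''
  have hL''P : L'' ∈ Classes.P :=
    mem_P_of_mem_FP hE L'' fun z => ⟨fun hz => hz, fun hz => (hbit z).resolve_left hz⟩
  have key : PromiseProblem.ofLanguage ({w | sem w = 0} : Language Bool) ∈ PromiseCoRP' := by
    refine mem_PromiseCoRP'_of_weak hL''P (coinPoly v d h) (gapPoly d h) (fun w hw y hy => ?_)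
      (fun w hw => ?_)
    · -- zero polynomials are always accepted
      have hw0 : sem w = 0 := hw
      change E (boolPair w y) = [true]
      rw [hspec w y hy]
      exact Or.inr (by rw [hw0, map_zero]; exact dvd_zero _)
    · -- nonzero polynomials are rejected with probability `≥ 1/(4K)`
      have hw0 : sem w ≠ 0 := hw
      set n := w.length with hn
      set V := v.eval n
      set k := kOf d h n
      set K := KOf d h n
      set Q := sem w
      -- the height bound
      have hheight : ∀ z : List Bool, (MvPolynomial.eval (ptOf k V z) Q).natAbs ≤ 2 ^ (2 ^ tOf d h n) := by
        intro z
        have hB : (1 : ℕ) ≤ 2 ^ k := Nat.one_le_two_pow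
        have ha : ∀ i, |ptOf k V z i| ≤ (2 ^ k : ℕ) := fun i => by
          rw [abs_of_nonneg (ptOf_nonneg k V z i)]
          exact_mod_cast (ptOf_lt k V z i).le
        have h1 := abs_eval_le Q hB ha
        have h2 : (∑ m ∈ Q.support, |Q.coeff m|) * ((2 ^ k : ℕ) : ℤ) ^ Q.totalDegree ≤
            (2 : ℤ) ^ (2 ^ h.eval n) * ((2 ^ k : ℕ) : ℤ) ^ (2 ^ d.eval n) := by
          refine mul_le_mul (hL1 w) (pow_le_pow_right₀ (by exact_mod_cast hB) (hdeg w))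
            (by positivity) (by positivity)
        have h3 : (2 : ℤ) ^ (2 ^ h.eval n) * ((2 ^ k : ℕ) : ℤ) ^ (2 ^ d.eval n) =
            2 ^ (2 ^ h.eval n + k * 2 ^ d.eval n) := by
          push_cast
          rw [← pow_mul, ← pow_add]
        have h4 : (2 : ℤ) ^ (2 ^ h.eval n + k * 2 ^ d.eval n) ≤ 2 ^ (2 ^ tOf d h n) :=
          pow_le_pow_right₀ (by norm_num) (height_exponent_le n)
        have h5 : |MvPolynomial.eval (ptOf k V z) Q| ≤ 2 ^ (2 ^ tOf d h n) :=
          h1.trans (h2.trans (h3 ▸ h4))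
        have h6 : (((MvPolynomial.eval (ptOf k V z) Q).natAbs : ℕ) : ℤ) ≤ ((2 ^ (2 ^ tOf d h n) : ℕ) : ℤ) := by
          rw [Int.natCast_natAbs]; exact_mod_cast h5
        exact_mod_cast h6
      have hwit := uniformProb_witness_ge (K := K) hw0 hheight
      -- numerics
      have hK2 : 2 ≤ K := two_le_KOf n
      have hKpos : (0 : ℝ) < K := by exact_mod_cast (show 0 < K by omega)
      have hprimes := card_primesBelow_two_pow_ge hK2
      have hN1 : (Q.totalDegree : ℝ) / 2 ^ k ≤ 1 / (8 * K) := by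
        have h8 : ((8 * KOf d h n * 2 ^ d.eval n : ℕ) : ℝ) ≤ ((2 ^ kOf d h n : ℕ) : ℝ) := by
          exact_mod_cast eight_K_two_pow_d_le n
        have hdeg' : (Q.totalDegree : ℝ) ≤ ((2 ^ d.eval n : ℕ) : ℝ) := by exact_mod_cast hdeg w
        push_cast at h8 hdeg'
        rw [div_le_div_iff₀ (by positivity) (by positivity)]
        nlinarith
      have hN2 : ((2 ^ tOf d h n : ℕ) : ℝ) + 2 ≤ 2 ^ K / (8 * K) := by
        have h8 : ((8 * KOf d h n * (2 ^ tOf d h n + 2) : ℕ) : ℝ) ≤ ((2 ^ KOf d h n : ℕ) : ℝ) := by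
          exact_mod_cast eight_K_height_le n
        push_cast at h8 ⊢
        rw [le_div_iff₀ (by positivity)]
        linarith
      have hgap : (1 : ℝ) / (((gapPoly d h).eval n : ℕ) + 1) = 1 / (4 * K) := by
        have := eval_gapPoly_add_one (d := d) (h := h) n
        have h' : (((gapPoly d h).eval n : ℕ) : ℝ) + 1 = 4 * K := by exact_mod_cast this
        rw [h']
      rw [hn] at hgap ⊢
      rw [hgap]
      -- the coin length is `K + V k`
      have hlen : (coinPoly v d h).eval w.length = K + V * k := eval_coinPoly _
      rw [hlen]
      -- the rejected coin strings contain the witnesses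
      have hmono : uniformProb (K + V * k)
          {y | ¬ (modOf K y ≤ 1 ∨ ((modOf K y : ℤ) ∣ MvPolynomial.eval (ptOf k V (y.drop K)) Q))} ≤
          uniformProb (K + V * k) {y | boolPair w y ∉ L''} := by
        refine BPExp.uniformProb_mono_len fun y hy hylen => ?_
        change ¬ E (boolPair w y) = [true]
        rw [hspec w y (by rw [hlen]; exact hylen)]
        exact hy
      refine le_trans ?_ (hwit.trans hmono)
      -- `1/(4K) ≤ (π' - T)/2^K - deg/2^k`
      have h2K : (0 : ℝ) < 2 ^ K := by positivity
      have hA : (2 : ℝ) ^ K / (2 * K) - 2 - (2 ^ tOf d h n : ℕ) ≤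
          ((2 ^ K).primesBelow.card : ℝ) - ((2 ^ tOf d h n : ℕ) : ℝ) := by linarith
      have hB : ((2 : ℝ) ^ K / (2 * K) - 2 - (2 ^ tOf d h n : ℕ)) / 2 ^ K ≤
          (((2 ^ K).primesBelow.card : ℝ) - ((2 ^ tOf d h n : ℕ) : ℝ)) / 2 ^ K :=
        div_le_div_of_nonneg_right hA h2K.le
      have hC : ((2 : ℝ) ^ K / (2 * K) - 2 - (2 ^ tOf d h n : ℕ)) / 2 ^ K =
          1 / (2 * K) - (((2 ^ tOf d h n : ℕ) : ℝ) + 2) / 2 ^ K := by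
        field_simp
        ring
      have hD : (((2 ^ tOf d h n : ℕ) : ℝ) + 2) / 2 ^ K ≤ 1 / (8 * K) := by
        rw [div_le_iff₀ h2K]
        calc ((2 ^ tOf d h n : ℕ) : ℝ) + 2 ≤ 2 ^ K / (8 * K) := hN2
          _ = 1 / (8 * K) * 2 ^ K := by ring
      have hE' : (1 : ℝ) / (4 * K) = 1 / (2 * K) - 1 / (8 * K) - 1 / (8 * K) := by
        field_simp
        ring
      push_cast at hB hC hD hN1 ⊢
      linarith
  exact ofLanguage_mem_PromiseCoRP'_iff.1 key

/-- **… and hence in `BPP`** (`coRP ⊆ BPP`, through the promise classes). [cite: AroraBarakCC2009, §7.3] -/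
theorem mem_BPP_of_modularZeroTest
    (sem : (w : List Bool) → MvPolynomial (Fin (v.eval w.length)) ℤ)
    (hdeg : ∀ w, (sem w).totalDegree ≤ 2 ^ d.eval w.length)
    (hL1 : ∀ w, ∑ m ∈ (sem w).support, |(sem w).coeff m| ≤ 2 ^ (2 ^ h.eval w.length))
    {E : List Bool → List Bool} (hE : E ∈ FP) (hbit : ∀ z, E z = [true] ∨ E z = [false])
    (hspec : ∀ w y, y.length = (coinPoly v d h).eval w.length →
      (E (boolPair w y) = [true] ↔
        (modOf (KOf d h w.length) y ≤ 1 ∨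
          ((modOf (KOf d h w.length) y : ℤ) ∣
            MvPolynomial.eval (ptOf (kOf d h w.length) (v.eval w.length) (pointSeg d h w.length y)) (sem w))))) :
    ({w | sem w = 0} : Language Bool) ∈ BPP :=
  ofLanguage_mem_PromiseBPP'_iff.1 (PromiseCoRP'_subset_PromiseBPP'
    (ofLanguage_mem_PromiseCoRP'_iff.2 (mem_coRP_of_modularZeroTest sem hdeg hL1 hE hbit hspec)))

end Main

end ModularZeroTest

end Literature.Computability.Complexity

end
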